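import Mathlib
import HarnessLib.Audit
import Summits.PneNP.PneNP.Theorems.PstarChordBridgeJoin
import Summits.PneNP.PneNP.Theorems.PstarNorUnitCoverTools
import Summits.PneNP.PneNP.Theorems.PstarChordBridgeFundamental
import Summits.PneNP.PneNP.Theorems.PstarChordBridge

/-!
# A tree edge of a terminal core lies on a fundamental cycle or in a join (no invisible bridges; E2/E1 counts; prover-1 g18)

FRONTIER range-avoidance ladder, rung F-N3 (`stmt-PneNP-19007`), cell `pnp-ideate` (this seat's `HOME/pnp-ideate-prover-1/g18/E2-PLAN-v3.md` §3:
the bridge paths of a core must be joins); restricted-model proof complexity — nothing here bears on `P` versus `NP`.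

Pure bookkeeping on bridge data (`PstarChordBridge.BridgeData`), no gate involved.  `mem_join_of_not_mem_fundamental`: if the tree `J₀ ∖ N` is
peelable, (T3) the system is unsolvable on `J₀` and (M0) solvable without the tree edge `t`, then **`t` lies on some fundamental cycle `D e` or in one
of the joins `T₁`, `T₂`**.  Proof: otherwise the Fredholm alternative `PstarNorUnitCoverTools.exists_even_or_cut` gives an everywhere-even family
through `t` — which puts `t` on a fundamental cycle (`exists_mem_fundamental_of_even`) — or a vertex labelling `x` with `x(u_j) + x(v_j) = [j = t]`
on `J₀`; flipping the XOR vertices labelled `1` (`PstarChordBridgeJoin.flipSet`) in the (M0)-solution of `J₀ − t` repairs `t`, keeps every other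
output (`eval_flipSet_iff`), and keeps both G-constraints (`gval_flipSet_iff`: the flipped part of `Cᵢ` is the set of odd vertices of `Tᵢ`
labelled `1`, of even size by the handshake `PstarChordBridgeTools.sum_pair_eq_sum_filter_odd` since `t ∉ Tᵢ`) — a solution of `J₀`, contradicting (T3).
So every output of a terminal core is a chord, a fundamental-cycle edge, or a join edge: the counts of the E2 nodes only have to pay for those.
-/

set_option linter.dupNamespace false -- `Summit.PneNP.PneNP.…`: summit = sub-problem name (D-0017 single-conjunct layout)

open Finset Literature.Computability.Complexity
open Summit.PneNP.PneNP.Theorems.PstarFibrePolys (bit)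
open Summit.PneNP.PneNP.Theorems.PstarTyped (Typed)
open Summit.PneNP.PneNP.Theorems.PstarGapOneAll (gval)
open Summit.PneNP.PneNP.Theorems.PstarXorElimination (pdeg)
open Summit.PneNP.PneNP.Theorems.PstarXCore (xpair xverts mem_xpair)
open Summit.PneNP.PneNP.Theorems.PstarChordBridgeTools (xpdeg not_mem_xverts_of_two_le sum_pair_eq_sum_filter_odd)
open Summit.PneNP.PneNP.Theorems.PstarChordBridge (BridgeData Solution)
open Summit.PneNP.PneNP.Theorems.PstarChordBridgeCotree (Peelable mem_xverts_iff_xpdeg_pos)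
open Summit.PneNP.PneNP.Theorems.PstarChordBridgeFundamental (odd_of_end)
open Summit.PneNP.PneNP.Theorems.PstarChordBridgeJoin (flipSet eval_flipSet_iff gval_flipSet_iff)
open Summit.PneNP.PneNP.Theorems.PstarNorUnitCoverTools (exists_even_or_cut exists_mem_fundamental_of_even)

namespace Summit.PneNP.PneNP.Theorems.PstarBridgeJoins

variable {n m : ℕ}

/-- The XOR ends of every output of a well-formed core are XOR vertices of the tree `J₀ ∖ N`. -/
theorem end_mem_xverts (I : LocalMap 4 n m) (hI : I.IsPure xorAndPred) {B : BridgeData n m} (hW : B.WF I) {j : Fin m} (hj : j ∈ B.J₀)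
    {s : Fin 4} (hs : s.val < 2) : I.vars j s ∈ xverts I (B.J₀ \ B.N) := by
  classical
  by_cases hjN : j ∈ B.N
  · have heD : j ∉ B.D j := fun h => (mem_sdiff.1 (hW.hD j hjN h)).2 hjN
    have hodd := odd_of_end I hI heD (hW.hDeven j hjN) hs
    have hpos : 0 < xpdeg I (B.D j) (I.vars j s) := Nat.pos_of_ne_zero fun h => by rw [h] at hodd; exact absurd hodd (by decide)
    have hmem := (mem_xverts_iff_xpdeg_pos I (B.D j) (I.vars j s)).2 hpos
    unfold PstarXCore.xverts at hmem ⊢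
    obtain ⟨k, hk, hv⟩ := mem_biUnion.1 hmem
    exact mem_biUnion.2 ⟨k, hW.hD j hjN hk, hv⟩
  · unfold PstarXCore.xverts
    refine mem_biUnion.2 ⟨j, mem_sdiff.2 ⟨hj, hjN⟩, (mem_xpair I).2 ?_⟩
    have : s = 0 ∨ s = 1 := by
      rcases s with ⟨s, hs4⟩
      simp only [Fin.ext_iff, Fin.val_zero, Fin.val_one]
      simp only at hs
      omega
    rcases this with rfl | rfl
    · exact Or.inl rfl
    · exact Or.inr rfl

/-- **No invisible bridges**: a tree edge of a terminal core lies on a fundamental cycle or in a join. -/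
theorem mem_join_of_not_mem_fundamental (I : LocalMap 4 n m) (hI : I.IsPure xorAndPred) (hT : Typed I) {B : BridgeData n m} (hW : B.WF I)
    (hPe : Peelable I (B.J₀ \ B.N)) (hT3 : ¬ ∃ z, Solution I B B.J₀ z) {t : Fin m} (ht : t ∈ B.J₀ \ B.N)
    (hM0t : ∃ z, Solution I B (B.J₀.erase t) z) : (∃ e ∈ B.N, t ∈ B.D e) ∨ t ∈ B.T₁ ∨ t ∈ B.T₂ := by
  classical
  by_contra hno
  push Not at hno
  obtain ⟨hnoD, ht₁, ht₂⟩ := hno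
  obtain ⟨htJ, htN⟩ := mem_sdiff.1 ht
  rcases exists_even_or_cut I B.J₀ htJ with ⟨Z, hZ, htZ, hZeven⟩ | ⟨x, hx⟩
  · obtain ⟨e, he, htD⟩ := exists_mem_fundamental_of_even I hPe hW.hD hW.hDeven hZ hZeven htZ htN
    exact hnoD e (mem_inter.1 he).2 htD
  · set F := B.J₀ \ B.N with hF
    set U : Finset (Fin n) := (xverts I F).filter (fun v => x v = 1) with hU
    obtain ⟨z, hzJ, hz1, hz2⟩ := hM0t
    have x01 : ∀ v, x v = 0 ∨ x v = 1 := fun v => by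
      generalize x v = a; revert a; decide
    have hUand : ∀ (j : Fin m) (s : Fin 4), 2 ≤ s.val → I.vars j s ∉ U := fun j s hs h =>
      not_mem_xverts_of_two_le I hT F j hs (mem_filter.1 h).1
    have hmemU : ∀ j ∈ B.J₀, ∀ s : Fin 4, s.val < 2 → (I.vars j s ∈ U ↔ x (I.vars j s) = 1) := fun j hj s hs => by
      rw [hU, mem_filter]; exact ⟨fun h => h.2, fun h => ⟨end_mem_xverts I hI hW hj hs, h⟩⟩
    set z' := flipSet U z with hz'
    -- every output of `J₀` holds at the flipped assignment
    have hsol : ∀ j ∈ B.J₀, I.eval z' j = B.y j := by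
      intro j hj
      have hxj := hx j hj
      have h0 := hmemU j hj 0 (by decide)
      have h1 := hmemU j hj 1 (by decide)
      by_cases hjt : j = t
      · subst hjt
        rw [if_pos rfl] at hxj
        have hne : I.eval z j ≠ B.y j := fun h =>
          hT3 ⟨z, fun k hk => if hkt : k = j then hkt ▸ h else hzJ k (mem_erase.2 ⟨hkt, hk⟩), hz1, hz2⟩
        have hflip : I.eval z' j ≠ I.eval z j := by
          intro h
          have hiff := (eval_flipSet_iff I hI hUand z j).1 h
          rw [h0, h1] at hiff
          have key : ∀ a b : ZMod 2, a + b = 1 → ¬ (a = 1 ↔ b = 1) := by decide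
          exact key _ _ hxj hiff
        revert hne hflip
        cases I.eval z' j <;> cases I.eval z j <;> cases B.y j <;> decide
      · rw [if_neg hjt] at hxj
        have hiff : (I.vars j 0 ∈ U ↔ I.vars j 1 ∈ U) := by
          rw [h0, h1]
          have key : ∀ a b : ZMod 2, a + b = 0 → (a = 1 ↔ b = 1) := by decide
          exact key _ _ hxj
        rw [(eval_flipSet_iff I hI hUand z j).2 hiff]
        exact hzJ j (mem_erase.2 ⟨hjt, hj⟩)
    -- both G-constraints are preserved: the flipped part of `Cᵢ` is the set of odd vertices of `Tᵢ` labelled `1`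
    have hcons : ∀ (T : Finset (Fin m)) (C : Finset (Fin n)) (G : Finset (Fin m)), T ⊆ F → t ∉ T →
        (∀ w, Odd (xpdeg I T w) ↔ w ∈ C ∧ w ∈ xverts I F) → gval I C G z' = gval I C G z := by
      intro T C G hTF htT hjoin
      rw [hz', gval_flipSet_iff I C (fun g _ => ⟨hUand g 2 (by decide), hUand g 3 (by decide)⟩) z]
      have hset : C.filter (fun v => v ∈ U) = (univ.filter fun w => Odd (xpdeg I T w)).filter (fun w => x w = 1) := by
        ext w
        simp only [mem_filter, mem_univ, true_and, hU, hjoin]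
        tauto
      have hsum : ∑ j ∈ T, (x (I.vars j 0) + x (I.vars j 1)) = 0 := by
        refine sum_eq_zero fun j hj => ?_
        rw [hx j (mem_sdiff.1 (hTF hj)).1, if_neg (fun h : j = t => htT (h ▸ hj))]
      rw [sum_pair_eq_sum_filter_odd] at hsum
      have hcount : ∑ w ∈ univ.filter (fun w => Odd (xpdeg I T w)), x w =
          ((((univ.filter fun w => Odd (xpdeg I T w)).filter (fun w => x w = 1)).card : ℕ) : ZMod 2) := by
        rw [← sum_boole]
        refine sum_congr rfl fun w _ => ?_
        rcases x01 w with h | h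
        · rw [h, if_neg zero_ne_one]
        · rw [h, if_pos rfl]
      rw [hset, ← ZMod.natCast_eq_zero_iff_even, ← hcount]
      exact hsum
    exact hT3 ⟨z', hsol, by rw [hcons B.T₁ B.C₁ B.G₁ hW.hT₁ ht₁ hW.hjoin₁]; exact hz1,
      by rw [hcons B.T₂ B.C₂ B.G₂ hW.hT₂ ht₂ hW.hjoin₂]; exact hz2⟩

end Summit.PneNP.PneNP.Theorems.PstarBridgeJoins
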